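import Literature.MathematicalPhysics.QuantumLattice.HubbardFermiSeaTangentRowsDiluteFarTPrime
import Literature.MathematicalPhysics.QuantumLattice.HubbardFermiSeaTangentRowsQuarterFilling
import Literature.MathematicalPhysics.QuantumLattice.HubbardNNNHoppingEnergyDensityMonotone
import Summits.Ventures.CertifiedManyBodySolver.Certificates.HubbardSquare_n1_deepSheet_farColumnFloors_E
import Summits.Ventures.CertifiedManyBodySolver.Certificates.HubbardSquare_n1_deepSheet_farColumnFloors_F
import Summits.Ventures.CertifiedManyBodySolver.Certificates.HubbardSquare_n1_deepSheet_farColumnFloors_G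
import Summits.Ventures.CertifiedManyBodySolver.Certificates.HubbardSquare_n1_deepSheet_farColumnFloors_K5a
import Summits.Ventures.CertifiedManyBodySolver.Certificates.HubbardSquare_n1_deepSheet_farColumnFloors_K5b
import Summits.Ventures.CertifiedManyBodySolver.Certificates.HubbardSquare_n1_deepSheet_farColumnFloors_K5c
import Summits.Ventures.CertifiedManyBodySolver.Certificates.HubbardSquare_n1_deepSheet_farColumnFloors_K5d
import Summits.Ventures.CertifiedManyBodySolver.Certificates.HubbardSquare_n1o2_farstrip_lower_jensen606_674_649
import Summits.Ventures.CertifiedManyBodySolver.Certificates.HubbardSquare_n7o8_TKT_obliqueStation_splitPlane_r554_r555_r590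
import Summits.Ventures.CertifiedManyBodySolver.Certificates.HubbardSquare_n7o8_splitPlane2_stage2_byName_discharge
import Summits.Ventures.CertifiedManyBodySolver.Certificates.HubbardSquare_n7o8_splitPlaneQ1_byName_readers
import Summits.Ventures.CertifiedManyBodySolver.Certificates.HubbardTTPrime_polarizedBandCaps_kernelB
import Summits.Ventures.CertifiedManyBodySolver.Observables.PhaseSeparationExclusionBox
import Summits.Ventures.CertifiedManyBodySolver.Observables.PhaseSeparationExclusionBoxZeemanTcap
import Summits.Ventures.CertifiedManyBodySolver.Observables.PhaseSeparationExclusionFarQuarterNodes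
import Summits.Ventures.CertifiedManyBodySolver.Observables.PhaseSeparationExclusionHalfFillingColumnU5
import Summits.Ventures.CertifiedManyBodySolver.Observables.PhaseSeparationExclusionHolePlaneCap
import Summits.Ventures.CertifiedManyBodySolver.Observables.PhaseSeparationExclusionLowUFarColumnsE
import Summits.Ventures.CertifiedManyBodySolver.Observables.PhaseSeparationExclusionQuarterConvexFloor
import Summits.Ventures.CertifiedManyBodySolver.Observables.PhaseSeparationExclusionSplitPlaneSevenEighthsCap
import Summits.Ventures.CertifiedManyBodySolver.Observables.PhaseSeparationExclusionStripPolCaps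
import Summits.Ventures.CertifiedManyBodySolver.Observables.PhaseSeparationExclusionVirtualColumns
import HarnessLib
import HarnessLib.Audit
import Summits.Ventures.CertifiedManyBodySolver.Observables.PhaseSeparationExclusionBoxGrandCanonicalTcap

/-!
# Ventures/CertifiedManyBodySolver — Observables/PhaseSeparationExclusionFarPolCVLUGAxesHE2mF.lean: `(≤ 1/2 | ≥ 1)` on segment E2m `t′ ∈ [-23 / 50, -9 / 20] × U ∈ [7 / 2, 16]` — FIELD axis (`T = 0` for every `|h| ≤ h₀·t`; `T > 0` for every `β ≥ β₀`, `|h| ≤ t/20`) («(2/5∣1) ON THE MAP AXES», g31)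

LOW-U COLUMN edition («THE FULL-POOL LOW-U FAR CORNERS», hubbard-downfold-unc-2 g45; generator `gen-g45/yb/gen45.py` over g44's): below `U = 49/10` (where hubbard-box-eng-2's deep-sheet files K5a–d stop) the `n = 1` column of every far cell is one of this seat's laws `lu45_n1_law_U<U>_m<a>m<b>` (`Observables/PhaseSeparationExclusionLowUFarColumns{A,…,E}.lean`, U ∈ {7/2, 15/4, 4, 41/10, 22/5, 9/2, 91/20, 23/5, 19/4}; + the 49/10 re-floor at −11/20/−1/2; second set `…{F,G,H}.lean` at U ∈ {3, 307/100, 79/25, 83/25, 69/20} on E1/E2/E3/A1/A2 with `h344` (CERTIFIED #344) as the low anchor): `t′`-chords of ≤3-row simplex corners (box-eng-2's `ds_n1_simplex3` / their LP engine run over the FULL tree pool) on the electron-doped-image n-tangent sheets `hsXA` ∕ `hsXA2` (surr-2 IMG-A/A2 (16/5, +31/50 ∣ +51/100), fast-ref F87 PASS) ∕ `hsJ7o2p65n9o10` read at `m = 1` and mirrored, and the K5 carriers `hsX49o10m64n1` ∕ `hsX717o100m64n1` ∕ `h497` ∕ `hB54` ∕ `hK5p50n1` (BY VALUE / BY NAME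 exactly as in the K5 laws): `e(1,s,U,1) ≥ −0.937 ∣ −0.919 ∣ −0.910 ∣ −0.900` at `(9/2; −11/20 ∣ −1/2 ∣ −9/20 ∣ −2/5)` where the g30 virtual columns (`fy1_vcol9o2_*`, `fp_n1_col7o2_*`) read −0.986 ∣ −0.974 ∣ −0.962 ∣ −0.950. FAR-END ANCHOR edition («THE FAR-END FREE ANCHORS», hubbard-downfold-unc-2 g44; generator `gen-g44/yb/gen44.py` over g43's): the hot dilute anchor of the `(≤ 9/20 ∣ ≥ 1)` words on the far segments Y2 / E1 / E2 (ends `t′ ∈ {−3/5, −11/20, −1/2}`) is the KERNEL free `t–t′` gas at `β* = 4` (`freeGCPressureTT'_b4_{tpm3o5,tpm11o20,tpm1o2}_n9o20_le`, `Certificates/HubbardTTPrime_freeGC_kernelQuadrature_b4_<t′>_dilute.lean`, APPEND editions of this seat g44: one `decide +kernel` quadrature table each, zero premises), `t′`-chord of the two segment-end certificates (the free pressure is convex in `βt′`). DEEP-XL COLUMN edition («THE DEEP-XL COLUMNS ON THE YBCO SLIVER», hubbard-downfold-unc-2 g44): on the slivers Y1v = [−16/25,−3/5] ⊇ Y1u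 ⊇ Y1s (YBCO NM64 ∕ M130 ∕ M18 far edges) the `n = 1` column at `U ∈ [49/10, 12]` is one of this seat's laws `xl64_n1_law_U<U>_m64m60` (`Observables/PhaseSeparationExclusionDeepXLColumnsY1v.lean`: `t′`-chords of the `U`-chorded deep XL half-filling rows at `s = −16/25` — `hsX49o10m64n1` ∕ `hsX717o100m64n1` ∕ `hsX10m64n1` BY VALUE, fast-ref F99 ∕ F103 PASS — with hubbard-box-eng-2's LANDED deep-sheet corners at `s = −3/5` BY NAME; joint `(s,U)`-concavity, `t′`- and `U`-monotonicity at `n = 1`): −0.90 ∣ −0.80 ∣ −0.70 ∣ −0.63 at `(U, s) = (5 ∣ 6 ∣ 7 ∣ 8, −16/25)` where the g30 kinetic/Fermi-sea columns read −1.25 ∣ −1.13 ∣ −1.08 ∣ −0.94. K5 CORNER-LAW edition («THE K5 CORNER LAWS», hubbard-downfold-unc-2 g42, families K5…; generator `gen-g42/yb/gen42.py` over g41's): the `n = 1` column of the far cells at `U ∈ [49/10, 13/2]` may now be one of hubbard-box-eng-2 g23's RE-FLOORED deep-sheet laws `ds2_n1_law_U<U>_m<a>m<b>` (`Certificates/HubbardSquare_n1_deepSheet_farColumnFloors_K5{a,b,c,d}.lean`,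 C-174, ref-3 § F3-121 PASS 92/92): `t′`-chords of LP-exact simplex corners (`ds_n1_simplex3`: joint concavity of `(s,U) ↦ e(1,s,U,1)`, evenness + `t′`-monotonicity at `n = 1`, `U`-monotonicity) of the K-R1′ `(5,1,+1/2)` half-filling row (`hK5p50n1` BY VALUE = the literal of CERTIFIED #803 (5, 1, +½) «X4» e₀ LOWER −507860049846727520828011/2⁷⁹, registry 13:13Z 2026-08-31, lit-4 claim node `cert_r803_bs_GU5n1tp1o2_…_uprime` p823802 — definitionally this binder; hubbard-algo-eng-8 twin-chain kit j342506, ref-3 R3.503), the M64 deep hole-side XL rows at `s = −16/25` (`hsX49o10m64n1` ∕ `hsX717o100m64n1`, fast-ref F99 ∕ F103 PASS), the B54 `(6,1,±3/10)` floor (`hB54`) and CERTIFIED #497 `(4,1,0)` BY NAME (`h497`): `(5,1,s) ≥ −0.8295 ∣ −0.8242 ∣ −0.8189` at `s = −2/5 ∣ −7/20 ∣ −3/10` (the flat `u5_n1_law_U5_m50p0` read −0.8402), `−0.8349` at `−9/20`; columns at `U = 49/10 ∣ 51/10 ∣ 133/25 ∣ 141/25 ∣ 6` and their `U`-chords `vk…`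 (`vcol_of_laws`) at `21/4 ∣ 11/2 ∣ 23/4`. The far quarter-filling points enter BY NAME: CERTIFIED #770 `(8,1/2,−2/5)` ∕ #783 `(6,1/2,−2/5)` claim nodes (`h770 : cert_r770_…` ∕ `h783 : cert_r783_…`, lit-4 p807955 ∕ p816497) through `hQ8m40_of_node` ∕ `hQ6m40_of_node` (`Observables/PhaseSeparationExclusionFarQuarterNodes.lean`, this seat). (5,1,+1/2) COLUMN edition (hubbard-downfold-unc-2 g41, families U5…): the `n = 1` column at `U ∈ [5, 6)` of the far cells with `|t′| ≤ 1/2` is the K-R1′ LEG B half-filling row (hubbard-algo-eng-8 g8 `twinchain-U5n1tp1o2-v082` kit j342506, see the law file's docstring for the exact literal and its class) read on the hole side by evenness + `t′`-monotonicity at `n = 1` (`u5_n1_law_U5_m50p0`, `Observables/PhaseSeparationExclusionHalfFillingColumnU5.lean`, hypothesis `hK5p50n1` BY VALUE) and its `U`-chords `vcol_of_laws` with the deep-sheet `U = 6` laws at `U ∈ {21/4, 11/2, 141/25, 23/4}` wherever they beat the deep-sheet `U = 5` column (−0.8716 ∣ −0.8632 ∣ −0.8548 at s = −1/2 ∣ −9/20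 ∣ −2/5). WAVE-7c ITEM 2 edition («THE U = 6 QUARTER POINT», hubbard-downfold-unc-2 g41, generator `gen-g41/yb/gen41.py …` over the g40/g39/g38 generators; floor kinds `Q649`/`Q6F` next to g40's `Q606`/`Q674`/`QF`): the DILUTE floor at `n₁ = 1/2` may now use the FIRST quarter-filling e₀ LOWER at `U = 6`, `t′ < −3/10` — hubbard-algo-eng-8 g7's `GU6n1o2tpm2o5` (6, 1/2, −2/5) one-job n-twin chain RESULT (EXACT) kit j341763, `E_cert = −2729691028003404047260271/(5·2⁷⁹)` ⇒ floor `−0.9031789987` (hubbard-fast WAVE 7c ITEM 2; CLAIM algoeng8-20260830-11; algo-ref g65 CELL-SIDE PASS «CANDIDATE class, C48 legs pending», KEEP CORRECT; crit-1 S#484 CLEAN, crit-2 #332 CONCUR, captain RULINGS #973/#976 2026-08-30T23:5xZ; registry row #783 SIGNED (sr-mbsolver-ref-3 R3.498-57s) ⇒ NOW CERTIFIED #783 and read BY NAME: binder `h783 : cert_r783_bs_GU6n1o2tpm2o5_…` (lit-4 g40 p816497) through `hQ6m40_of_node` (`Observables/PhaseSeparationExclusionFarQuarterNodes.lean`)):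 on `[−2/5, −3/10]` its `t′`-chord with the CERTIFIED #649 `(6,1/2,−3/10)` lower (−0.9412223802) at `U = 6` carried up in `U` (`−0.9032 ∣ −0.9222 ∣ −0.9412` at `s = −2/5 ∣ −7/20 ∣ −3/10`, i.e. `+0.053 ∣ +0.026 ∣ 0` over the #649 Jensen floor and `+0.044 ∣ +0.015` over #606's for `U < 8`), and on `[−11/20, −2/5]` its `(t′,U)`-Jensen chord with the kernel free row at `t′ = −11/20` (`−0.9082` at `s = −41/100`, `−0.9283` at `−9/20`; valid for `U ≥ 40(s + 11/20)`, i.e. from `U = 6` at `s = −2/5` where the `U = 8` point needs `U ≥ 8`); extrapolated down the density by convexity for `(≤ 9/20 ∣ ≥ 1)` / `(≤ 2/5 ∣ ≥ 1)` exactly as the Q8/J floors. The STAGE-2 `7/8` plane is read BY NAME (`n7o8_splitPlane2_hW2m_of_node hW2o3` on `cert_plaqseam_W4splitO3_TBDP_allmk`, hubbard-fast-reuse-2 g21) wherever it caps. DEEP-SHEET COLUMN edition («THE FAR COLUMN REPAIR», hubbard-downfold-unc-2 g40, families DS/DSH200/DSH80): the `n = 1` COLUMNS of every far cell are hubbard-box-eng-2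 g22's DEEP-SHEET far column laws `ds_n1_law_U<U>_m<a>m<b>` BY NAME (`Certificates/HubbardSquare_n1_deepSheet_farColumnFloors_{B..I}.lean`, 2026-08-30T21:27Z: LP-exact simplex floors from the deep hole-side M64 XL rows at `s = −16/25` (`hsX49o10m64n1` ∕ `hsX717o100m64n1` ∕ `hsX10m64n1`, fast-ref F99/F103 PASS), the electron-side B54/B67c/B85c rows, the S1/S9 sheets and #497, by `t′`-monotonicity of `e(1,·,U,1)` on `s ≤ 0` (evenness + concavity) + `U`-monotonicity + joint concavity; `+0.05…0.21·t` over every earlier far column incl. this seat's (8,12)-chords and corner chords) wherever they are the best law on the cell's segment (the theorem docstrings name the law per column); their by-value binders appear in each signature exactly as the law files print them. WAVE-7c QUARTER-POINT edition (this file; hubbard-downfold-unc-2 g40, generator `gen-g40/yb/gen40.py … ` with the `Q606`/`Q674`/`QF` floor kinds): the DILUTE floor at `n₁ = 1/2` may now use the FIRST quarter-filling e₀ LOWER at `t′ < −3/10` — hubbard-algo-eng-8 g7's `GU8n1o2tpm2o5` (8, 1/2, −2/5) twin-chain RESULT (EXACT) kit j341204, `E_cert = −676700214379598560086999/(5·2⁷⁷)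 = −0.8956052766` (hubbard-fast WAVE 7c ITEM 1; crit-2 VERDICT #315, surr-4 SCORE, crit-1 S#467 CLEAN, captain RULINGS #919 «PRINTED, KEEP-class CANDIDATE», 2026-08-30T20:19–20:25Z; registry row #783 SIGNED (sr-mbsolver-ref-3 R3.498-57s) ⇒ hypothesis `hQ8m40 : −0.8956052766… ≤ e(1, −2/5, 8, 1/2)` BY VALUE, CANDIDATE class, discharged BY NAME by a one-line wrapper the hour the node lands): on `[−2/5, −3/10]` its `t′`-chord with the CERTIFIED #606 `(8,1/2,−3/10)` (−0.9270952558) ∣ #674 `(10,1/2,−3/10)` (−0.9178886431) lowers at `U = 8 ∣ 10` carried up in `U` (`−0.8956 ∣ −0.9113 ∣ −0.9271` at `s = −2/5 ∣ −7/20 ∣ −3/10`, i.e. `+0.052 ∣ +0.026` over the #606 Jensen floor and `+0.047 ∣ +0.019` over #674's), and on `[−11/20, −2/5]` its `(t′,U)`-Jensen chord with the kernel free row at `t′ = −11/20` (`−0.9011` at `s = −41/100`, `+0.044`; valid for `U ≥ 160(s + 11/20)/3`); extrapolated down the density by convexity for `(≤ 9/20 ∣ ≥ 1)` / `(≤ 2/5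 ∣ ≥ 1)` exactly as the J-floors. FAR VIRTUAL-COLUMN edition («THE (8,12) CHORD», hubbard-downfold-unc-2 g40, generator `gen-g40/yb/gen40.py …`): on the far strips the `n = 1` COLUMNS at `U⋆ ∈ {42/5, 17/2, 9, 10, 11}` are now VIRTUAL columns (`vcol_of_laws`, `Observables/PhaseSeparationExclusionVirtualColumns.lean`, g37 device: concavity of `U ↦ e(1,s,U,1)`, the `U`-chord of two LANDED column laws read at `U⋆`) of the `U = 8` law `ext5_n1_col8_m40` ∕ `fp_n1_col8_m65m40` and the `U = 12` law `fp_n1_col12_m50m30` ∕ `fp_n1_col12_m65m50` BY NAME (their producer anchors `hsX8m40n1`, `h428`, `hN12m50`, `hsX12m30n1`, … exactly as printed in those laws): on `[−2/5,−3/10]` the chord reads `−0.5465 ∣ −0.4814` at `(10, s = −2/5 ∣ −3/10)` and `−0.5615 ∣ −0.5471` at `U⋆ = 17/2`, i.e. `0.065–0.093·t` ABOVE the N1-tier point floors `hN10m40`/`hN10m35` (`far_n1_col10_m40m35` −0.6110 ∣ −0.5917, `far_n1_law10`) and the box-eng sheet column `fy1_col17o2_m40m30` (−0.6475 ∣ −0.6402)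 that every earlier far edition used at `U = 17/2, 9, 10, 11` — the loosest ingredient of the far words was the `n = 1` column, not the cap: `(≤ 1/2 ∣ ≥ 1)` `T = 0` margins on A2 `[8,10] ∣ [10,12]` 0.033 ∣ 0.036 → 0.077 ∣ 0.074, A1 0.034 → 0.063 ∣ 0.057, E3c 0.036 → 0.056; no new row, no new hypothesis kind. 7/8-WITNESS menu («THE 7/8 WITNESS», hubbard-downfold-unc-2 g40, generator `gen-g40/yb/gen40.py …` over the g39/g38/g31 generators): the CAP menu of every cell now also holds the FOUR `n = 7/8` WITNESS-SPLIT cap planes of the pub/hubbard-fast reuse lane (reader spelling `∀ U s, 0 ≤ U → s ≤ 0 → e(1,s,U,7/8) ≤ T⁺ + D⁺·U + (−B⁺)·s`, cell form `holePlaneUS_tcap_on_cell`, `Observables/PhaseSeparationExclusionSplitPlaneSevenEighthsCap.lean`, this seat g40): the folded-Q1 `(5,7/8,−3/10)` state's plane BY NAME (`n7o8_splitPlaneQ1_of_split hQ1`, node `cert_plaqseam_W4splitQ1_TBD_allmk`, CERTIFIED #693–#695; lowest `7/8` cap for `U ≲ 6.0–6.3`), the #596 `(8,7/8,−3/10)`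 state's plane BY NAME (`n7o8_splitPlane_of_split hS596`, node `cert_plaqseam_W4split596_TBD_allmk`, CERTIFIED #610–#612), the STAGE-2 plane BY VALUE (`hW2m`, R12.52; lowest for `6.3 ≲ U ≲ 8.9–10.5`) and the V18 «WSP7» plane of the CERTIFIED dressed `(12,7/8,−3/10)` strip state BY VALUE (`hW7m`, R12.91 ×3, readers p782947; lowest above) — so the witness filling of a word may be `7/8` (weights `a = (1/8)/(1 − n₁)`, `b = 1 − a`: the dilute floor weighs `1/4` at `n₁ = 1/2` instead of `1/2` with the `3/4` planes), chosen per cell whenever it gives the better word (lower `β₀` ∕ larger margin ∕ stronger axis); every other ingredient as in the g39/g38 editions below. FAR-STRIP QUARTER-FLOOR edition («THE FAR-STRIP QUARTER FLOOR», hubbard-downfold-unc-2 g39, generator `gen-g39/yb/gen39.py far …` over the g38/g31 far-strip generators): the DILUTE FLOOR (`hF₁` slot) of every far cell is the best of (i) the ORACLE DESK's far-strip QUARTER floors — Jensen in `(t′, U)` for the jointly concave `(t′,U) ↦ e` between ONE certified registry row at `(U₁, 1/2, −3/10)` (#674 `U₁ = 10` ∣ #606 `U₁ = 8` ∣ #649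 `U₁ = 6`, claim nodes `h674`/`h606`/`h649` BY NAME) and the kernel free row at `t′ = −11/20`, then Griffiths monotonicity in `U`: `c₀ + c₁·s ≤ e(1,s,U,1/2)` for `s ∈ [−11/20,−3/10]`, `U ≥ (4s+11/5)·U₁` (`n1o2_farJensen{674,606,649}_strip_of`, `Certificates/HubbardSquare_n1o2_farstrip_lower_jensen606_674_649.lean`, hubbard-fast-surr-4 g10, p775085; `−0.9421 ∣ −0.9300` at `s = −2/5 ∣ −7/20` from #674 vs the FREE sea `−1.0206 ∣ −1.0532`: lifts `+0.078 ∣ +0.123`), used as is for `(≤ 1/2 ∣ ≥ 1)` and EXTRAPOLATED DOWN THE DENSITY by convexity of `n ↦ e` against the cell's best cap at `n₀ > 1/2` (`dilute_floor_of_halfFloor_of_cap`, g35) for `(≤ 9/20 ∣ ≥ 1)` / `(≤ 2/5 ∣ ≥ 1)`, and (ii) the free Fermi-sea `t′`-chord of the earlier editions — whichever gives the better word per cell (named in each docstring). RESULT: the FIRST `(≤ 1/2 ∣ ≥ 1)` words at `t′ < −3/10` (A1 `[−2/5,−7/20]`, A2 `[−7/20,−3/10]`, E3c `[−41/100,−2/5]`,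 E3 `[−9/20,−2/5]`). V16 FAR-STRIP edition («THE #660 PLANE», hubbard-downfold-unc-2 g38, generator `gen-g38/yb/gen38.py far …` over the g31 far-strip generators `gen31_cells.py` / `gen31_axes.py` / the K1 law): CAP per cell = the best of the tree's real-parameter caps on the segment — here almost everywhere the WITNESS-SPLIT PLANE of the CERTIFIED #660 strip state `(8, 3/4, −3/10)` at filling `3/4` (`T⁺ − B⁺·s + D⁺·U`, literals of record `−4440523991983/2⁴² ∣ 214787725653/2⁴⁴ ∣ 91533771269/2⁴²`, sr-mbsolver r211 V16, R12.73-signed; hypothesis `hV16` BY VALUE, cell form `holePlane_tcap_on_cell`, `Observables/PhaseSeparationExclusionHolePlaneCap.lean`; discharged BY NAME by a one-line `wsplit660_capPlane_of h660` the hour lit-4's claim node lands): a `t′ = −3/10` state, `0.05–0.10·t` below the WS597 plane (a `t′ = 0` state) and `0.02–0.07·t` below the kernel polarised caps on `t′ ∈ [−9/20, −3/10]`, `U ∈ [5, 13]`; DILUTE floors = `t′`-chords of the premise-free kernel Fermi-sea tangent rows (free sea; the far strip has no certified quarter-side LOWER); `n = 1` COLUMNS = the landed column laws BY NAME plus VIRTUAL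 columns (`vcol_of_laws`, `U`-chords of two landed laws: `fp_n1_col5_m40m30 ⊕ lowU_n1_law13o2_m40m30` at `U = 141/25, 32/5` on `[−2/5,−3/10]`, `fp_n1_col5_m55p0 ⊕ fp_n1_col8_m65m40` at `U = 141/25, 71/10` on `[−11/20,−2/5]` — the U_min edges 5.64 / 6.4 / 7.1 of the Bi2201 / NaCCOC-x0.20 / CCOC boxes) and gen33's `U = 6` A-segment column `es_n1_law6_m50m30` (BY VALUE `hN6m50`, `hB54`); `T > 0` dilute anchors = kernel free gas `β* = 4` incl. the NEW `n₁ = 9/20` certificates at `t′ = −9/20, −2/5, −7/20` (p767135–p767137, this seat g38). RESULT: `(≤ 9/20 ∣ ≥ 1)` — never typed before on `t′ < −3/10` — holds on A2 `[−7/20,−3/10] × [6, 13]` (margins 0.016–0.053), A1 `[−2/5,−7/20] × [32/5, 13]` (0.029–0.084), E3c `[−41/100,−2/5] × [141/25, 13]` (0.013–0.093), E3/E3s/E3t `× [8, 12]` (0.075–0.085): whole-box for Ca₂₋ₓNaₓCuO₂Cl₂ M36/M58 `[−0.41,−0.3] × [7.1,12.4]` and NaCCOC-x0.20 M57 `[−0.38,−0.27]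 × [6.4,12.9]`; `(≤ 2/5 ∣ ≥ 1)` NEW down to `U = 5` on A1/A2/E3c (Bi2201 M61/M62 `[−0.411,−0.31] × [5.64,7.27]`, PrSrNiO₂ M39b) and every A-strip threshold re-priced. Theorem names `gv…`/`gw…`. HONEST FRAMING: first certified bounds; not a superconductivity verdict. CLASS = DERIVED / CONTEXT (competing-order words, CONTROL class: the excluded partner phase has
hole doping `≥ 1/2`). PURPOSE: the field / chemical-potential / interlayer ROBUSTNESS annex of the phase maps (D-0098) for the `(≤ 2/5 ∣ ≥ 1)` sentence, which the
T = 0 table (hubbard-box-p3 psbox v1.10) carries on YBCO M18/M130/M64, Bi2212, CCOC, NdNiO₂, Bi2201, CB1 and the La-214 boxes but which had NO axis word anywhere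
(CB1's `T > 0` β ≥ 14 aside). Same column data as the `T > 0` words of `Observables/PhaseSeparationExclusionHalfOneDiluteAnchorsFar.lean` (this seat g31): CAP per cell = the
best real-parameter cap of the tree (kernel FULLY-POLARISED band caps of hubbard-box-p3 g33, `U`-independent, no claim node; or the WS597 witness-split plane of the
certified #597 state at filling `3/4`, hubbard-box-p3 g34, claim node BY NAME; or kernel HF / registry r468) — named per theorem; `n = 1` COLUMNS = landed laws BY NAME
(producer anchors BY VALUE in each signature: XL n-sheets `hsX…` at `m = 1`, CANDIDATE class where not referee-replayed; N-tier points; registry nodes / K2DIAG bootstraps BY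
NAME); DILUTE floor = the #674-COLUMN floor of `Observables/PhaseSeparationExclusionQuarterConvexFloorB.lean` (quarter rows BY NAME); `T > 0` anchors = kernel free gas `β* = 4` + a-priori `2 log 2` (no thermal claim node). Laws:
`psH_not_fieldGroundState_mix_on_cell_of_columns_tcap` / `psHT_not_fieldEquilibrium_mix_on_cell_of_columns_hotAnchorSS_tcap` (`…BoxZeemanTcap`),
`psGC_gap_on_cell_of_columns_tcap` / `psGCT_not_equilibrium_on_cell_of_columns_hotAnchorSS_tcap` (`…BoxGrandCanonicalTcap`), `psL_not_layeredGroundState_mix_on_cell_of_columns_tcap`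
(`…BoxLayeredTcap`) — this seat g22–g26. Per cell the LARGEST admissible parameter of the menus `h₀ ∈ {1/4 … 1/40}`, `G ∈ {5/4 … 1/20}`, `k ∈ {3/20 … 1/40}` is stated
(cost `h₀·n̄`, `G·a·b·(1−n₁)`, `k` against the exact `T = 0` column margins; kernel re-check by `nlinarith`). Cells: `[19 / 4,49 / 10]` ∣ `[49 / 10,5]` ∣ `[5,51 / 10]` ∣ `[51 / 10,21 / 4]` ∣ `[21 / 4,133 / 25]` ∣ `[133 / 25,11 / 2]` ∣ `[11 / 2,141 / 25]` ∣ `[141 / 25,6]` ∣ `[6,32 / 5]` ∣ `[32 / 5,13 / 2]` ∣ `[13 / 2,7]` ∣ `[7,71 / 10]` ∣ `[71 / 10,8]` ∣ `[8,17 / 2]` ∣ `[17 / 2,10]` ∣ `[10,12]` ∣ `[12,13]` ∣ `[13,16]`.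
WHAT THIS IS NOT: a certificate or number of record; CONTROL-class words conditional BY NAME / BY VALUE on the premises printed in each signature; field / grand-canonical /
layered ground states and equilibria as variational notions (existence not claimed); `κ = (4/π)Σ|t_z|` is the crude linear interlayer cost; nothing about stripes as states,
ferromagnetism, superconductivity or `T_c`.

Seat hubbard-downfold-unc-2 g31; generator `pub/hubbard-downfold/hubbard-downfold-unc-2/gen-g31/yb/gen31_axes.py` (= g30's gen30_axes.py over the g31 cell tables).
[cite: Israel1979, Thm. I.2.4] [cite: LiebPRL1989, proof of Theorem 1] [cite: PoulinHastings2011, eqs. (3)–(8)] [cite: Griffiths1964, §II] [cite: Israel1979, Thm. I.2.4] [cite: EmeryKivelsonLin1990, pp. 475–476] [cite: Ruelle1969, §3.3] [cite: BratteliKishimotoRobinson1978, Thm. 2 (condition 2)] [cite: BachLiebSolovej1994, eq. (2c.36)] [cite: LiebLoss1993, §8, Theorem 8.2]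
-/

noncomputable section

namespace Summit.Ventures.CertifiedManyBodySolver.Observables

open Summit.Ventures.CertifiedManyBodySolver.Certificates Summit.Ventures.CertifiedManyBodySolver.Downfold
open Literature.MathematicalPhysics.QuantumLattice Literature.MathematicalPhysics.QuantumLattice.ThermodynamicLimit
open Literature.MathematicalPhysics.QuantumLattice.InfVolFermionState Set Filter

/-- **`(≤ 1/2 | ≥ 1)` IN THE FIELD, `T = 0`: segment E2m `t′ ∈ [-23 / 50, -9 / 20] × U ∈ [19 / 4, 49 / 10]`, every `|h| ≤ 1/400·t`** (`≈ 19 T` at `t = 0.44 eV`;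
cap = the WITNESS-SPLIT PLANE of the CERTIFIED #660 state `(8, 3/4, −3/10)` at filling `3/4` (sr-mbsolver r211 V16: RESULT hubbard-upper-eng-1 g19 2026-08-30T08:28Z, referee signature ref-12 g44 R12.73 ×3 at the literals of record `T⁺ = −4440523991983/2⁴²`, `B⁺ = 214787725653/2⁴⁴`, `D⁺ = 91533771269/2⁴²`; CERTIFIED rows / Lean node pending at generation time) — `e(1,s,U,3/4) ≤ −1.0096583 − 0.0122093·s + 0.0208124·U` for `s ≤ 0`, `U ≥ 0`, hypothesis `hV16` BY VALUE, cell form `holePlane_tcap_on_cell` (`Observables/PhaseSeparationExclusionHolePlaneCap.lean`, this seat g38) at filling `3 / 4`, field cost `1/400·3 / 4 = 0.0019` against the column margins `U = 19 / 4`: M 0.0024∣0.0060; `U = 49 / 10`: M 0.0111∣0.0147; `n = 1` columns `lu45_n1_law_U19o4_m50m45` ∣ `lu45_n1_law_U49o10_m50m45` BY NAME):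
no `(≤ 1/2 ∣ ≥ 1)` mixture of translation-invariant states is a ground state of `H(1,s,U) − h·(N↑ − N↓)` at its filling. [cite: Israel1979, Thm. I.2.4] [cite: Griffiths1964, Appendix] [cite: EmeryKivelsonLin1990, pp. 475–476] -/
theorem yeH_1o2_E2m_19o4to49o10_h1o400 (hV16 : ∀ s U : ℝ, s ≤ 0 → 0 ≤ U → energyDensityTT' 1 s U (3 / 4) ≤ ((-4440523991983/4398046511104 : ℚ) : ℝ) + ((-214787725653/17592186044416 : ℚ) : ℝ) * s + ((91533771269/4398046511104 : ℚ) : ℝ) * U) (h783 : cert_r783_bs_GU6n1o2tpm2o5_w3_b4_R2_ob5p2_kry1_kry2c3rel_hanK7B4D4_KN4_PR20d4_hanK8c2s_uprime) (hsXA2 : ∀ m : ℝ, 0 ≤ m → m < 2 → (((-5702960828472302874806083/1888946593147858085478400 : ℚ)) : ℝ) + (((2081243748641/1099511627776 : ℚ)) : ℝ) * m ≤ energyDensityTT' 1 (51/100) (16/5) m) (h497 : cert_r497_hubSQ_hanK7R6_U4_r5_e4_so4blk) (hK5p50n1 : ((-507860049846727520828011/604462909807314587353088 : ℚ) : ℝ)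 ≤ energyDensityTT' 1 (1 / 2) 5 1)
    {s : ℝ} (hs : s ∈ Icc (-23 / 50 : ℝ) (-9 / 20)) {U : ℝ} (hU : U ∈ Icc (19 / 4 : ℝ) (49 / 10))
    {hz : ℝ} (hh : |hz| ≤ 1 / 400)
    {ω₁ ω₂ : InfVolFermionState 2} (h₁ : ω₁.IsTranslationInvariant) (h₂ : ω₂.IsTranslationInvariant)
    (hρ₁ : 0 < ω₁.density) (hρ₁' : ω₁.density ≤ 1 / 2) (hρ₂ : 1 ≤ ω₂.density) (hρ₂' : ω₂.density < 2)
    {lam : ℝ} (hl0 : 0 < lam) (hl1 : lam < 1) :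
    (gcInteractionTT' 1 s U 0 hz).tiGroundEnergyDensityAt 1 (mix lam hl0.le hl1.le ω₁ ω₂).density <
      (mix lam hl0.le hl1.le ω₁ ω₂).meanEnergy (gcInteractionTT' 1 s U 0 hz) 1 := by
  refine psH_not_fieldGroundState_mix_on_cell_of_columns_tcap 1 (s₁ := -23 / 50) (s₂ := -9 / 20) (U₁ := 19 / 4) (U₂ := 49 / 10)
    (n₁ := 1 / 2) (n₂ := 1) (a := 1 / 2) (b := 1 / 2) (c₀ := ((-4440523991983/4398046511104 : ℚ) : ℝ)) (cs := ((-214787725653/17592186044416 : ℚ) : ℝ)) (c₁ := ((91533771269/4398046511104 : ℚ) : ℝ)) (h₀ := 1 / 400)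
    (by norm_num) (by norm_num) (by norm_num) (by norm_num) (by norm_num) (by norm_num) (by norm_num) (by norm_num)
    (holePlane_tcap_on_cell hV16 (by norm_num) (by norm_num) (by norm_num))
    (fun s hs => lu45_n1_law_U19o4_m50m45 hsXA2 h497 hK5p50n1 s ⟨hs.1.trans' (by norm_num), hs.2.trans (by norm_num)⟩)
    (fun s hs => lu45_n1_law_U49o10_m50m45 hsXA2 h497 hK5p50n1 s ⟨hs.1.trans' (by norm_num), hs.2.trans (by norm_num)⟩)
    (fun s hs U hU => n1o2_farJensen_floor_of_anchor_of_free 1 (n := 1 / 2) (by norm_num) (by norm_num) (U₁ := 6) (by norm_num) (s₀ := -2 / 5) (s₁ := -11 / 20) (by norm_num)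
      (hQ6m40_of_node h783) n1o2_free_tpm11o20_U0 s ⟨hs.1.trans' (by norm_num), hs.2.trans (by norm_num)⟩ U (by obtain ⟨h1, h2⟩ := hs; norm_num; linarith [hU.1]))
    hh ?_ ?_ hs hU h₁ h₂ hρ₁ hρ₁' hρ₂ hρ₂' hl0 hl1
  · intro s hs; obtain ⟨h1, h2⟩ := hs; push_cast; norm_num; nlinarith [h1, h2]
  · intro s hs; obtain ⟨h1, h2⟩ := hs; push_cast; norm_num; nlinarith [h1, h2]

end Summit.Ventures.CertifiedManyBodySolver.Observables

end
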